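import Literature.MathematicalPhysics.KineticTheory.CollisionFluxUpperBound
import HarnessLib

/-!
# `LambertianContactSwap.CollisionMomentBound` (stmt-AtomisticToContinuum-12102): the collision-flux
# (window) bound in EXPECTATION form

Helper file (`--supports stmt-AtomisticToContinuum-12102`).  The item asks for a bound on the MEAN
(`∫⁻`) of a weighted collision count, uniformly in `N`.  The tree's collision-flux machinery
(`Literature.MathematicalPhysics.KineticTheory.CollisionFluxUpperBound`: Cercignani–Illner–Pulvirenti
1994 App. 4.A, "configurations leading to a collision in a short time interval") exports only the
Markov/TAIL form `P{z good, K_F(z) ≥ η} ≤ η⁻¹ · liminf_M M ∫ W_M dP`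
(`measure_collisionSum_ge_le_liminf`, `localGibbsLaw_collisionMarkSum_ge_le`), from which the mean
cannot be recovered (an `η⁻¹` tail is not integrable).  This file re-runs the same argument one step
earlier, before Markov's inequality, and records the bound on the mean itself:

* `lintegral_indicator_collisionSum_le_liminf` — for a hard-sphere flow `Φ`, a law `P` preserved by
  every `Φ_t`, a mark `F ≥ 0` on (post-collisional configuration, ordered pair), window events
  `E_M(i,j) ⊇ {(i,j) reaches contact under a backward free flight of duration ≤ τ/M}` and measurable
  majorants `F̃_M ≥ F` along those flights:
  `∫⁻ 𝟙_{good}(z) · Σ_{collision times s ∈ [0,τ]} Σ_{i ≠ j at contact} F(Φ_s z, i, j) dP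
     ≤ liminf_M M · ∫ Σ_{i≠j} 𝟙_{E_M(i,j)} F̃_M(·,i,j) dP`
  (pathwise grid domination `sum_collision_le_sum_window` once the mesh is below the gap of the
  collision times, Fatou, stationarity — verbatim the first three steps of
  `measure_collisionSum_ge_le_liminf`);
* `lintegral_indicator_collisionMarkSum_le` — the rung-0 specialisation on `𝕋³`: under the homogeneous
  Gibbs law `G_N = localGibbsLaw σ a u θ N Φ` (constant profiles, `Φ`-invariant), for an `ℝ≥0∞`-valued
  measurable mark `b(vᵢ, vⱼ)` of the two velocities,
  `∫⁻ 𝟙_{good} · Σ_{collisions in [0,τ]} Σ_{i≠j at contact} b(vᵢ, vⱼ) dG_N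
     ≤ 16 τ (N+1)² ε_N² · ∫ ‖w − v‖ b(v, w) dN(u,θ)(v) dN(u,θ)(w)`,
  given the same three static inputs as `localGibbsLaw_collisionMarkSum_ge_le` (canonical pair law
  `≤ 4 ×` Haar, swept tubes of volume `≤ 4 ε² h ‖u‖`, Haar-versus-Lebesgue for minimal-image lifts).
  With `(N+1) ε_N³ = σ³` the right side is `16 τ σ² (N+1)^{4/3} · I(b)`: the Boltzmann–Enskog collision
  flux bounds the mean weighted collision count, uniformly in `N` after the item's `(N+1)^{-4/3}`.

References: C. Cercignani, R. Illner, M. Pulvirenti, *The Mathematical Theory of Dilute Gases* (1994),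
App. 4.A; I. Gallagher, L. Saint-Raymond, B. Texier, *From Newton to Boltzmann* (2013), Prop. 4.1.1;
H. Spohn, *Large Scale Dynamics of Interacting Particles* (1991), Part I §2.3.
-/

noncomputable section

open MeasureTheory Set Filter Topology
open scoped ENNReal InnerProductSpace BigOperators

namespace Summit.AtomisticToContinuum.HydrodynamicLimit.Theorems.LambertianContactSwapCollisionMomentBound

open Literature.Analysis.FluidPDE Literature.Analysis.FunctionSpaces
  Literature.MathematicalPhysics.KineticTheory

/-! ### The window bound for the mean of a collision sum under an invariant law -/

/-- **The collision-flux (window) upper bound for the MEAN collision sum** (Cercignani–Illner–Pulvirenti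
1994 App. 4.A).  For a hard-sphere flow `Φ`, a law `P` preserved by every `Φ_t`, `τ > 0`, an arbitrary
mark `F(w, i, j) ∈ ℝ≥0∞` of the post-collisional configuration and the ordered colliding pair, measurable
window events `E M i j` containing every non-overlapping configuration whose pair `(i, j)` comes to
contact after a backward free flight of some duration `t ∈ [0, τ/M]`, and measurable majorants
`F (S_{−t} w, i, j) ≤ F̃ M w i j` in that situation:
`∫⁻ 𝟙_{good}(z) Σ_{collision times s ∈ [0,τ]} Σ_{i ≠ j at contact in Φ_s z} F(Φ_s z, i, j) dP(z)
   ≤ liminf_M  M · ∫ Σ_{i≠j} 𝟙_{E M i j} F̃ M (·, i, j) dP`.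
Pathwise the collision sum of a good orbit is eventually below the grid sum `Σ_{k=1}^{M} W_M(Φ_{kτ/M} z)`
(`sum_collision_le_sum_window`), hence below the measurable `liminf_M` of the grid sums; Fatou and
stationarity bound the mean of the latter.  (`measure_collisionSum_ge_le_liminf` is this followed by
Markov's inequality.) [folklore] -/
theorem lintegral_indicator_collisionSum_le_liminf {d X : Type*} [Fintype d] [MeasureSpace X]
    [TopologicalSpace X] {G : Geometry d X} {ε : ℝ} {n : ℕ} (Φ : HardSphereFlow G ε n)
    (P : Measure (Config n d X)) (hstat : ∀ t : ℝ, MeasurePreserving (Φ.flow t) P P) {τ : ℝ}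
    (hτ : 0 < τ) (F : Config n d X → Fin n → Fin n → ℝ≥0∞)
    (E : ℕ → Fin n → Fin n → Set (Config n d X)) (hEm : ∀ M i j, MeasurableSet (E M i j))
    (hE : ∀ (M : ℕ) (i j : Fin n), i ≠ j → ∀ w ∈ hardSphereDomain G n ε, ∀ t ∈ Icc 0 (τ / M),
      ‖G.sepVec ((freeFlight G (-t) w i).1) ((freeFlight G (-t) w j).1)‖ = ε → w ∈ E M i j)
    (Ft : ℕ → Config n d X → Fin n → Fin n → ℝ≥0∞) (hFtm : ∀ M i j, Measurable fun w => Ft M w i j)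
    (hFt : ∀ (M : ℕ) (i j : Fin n), i ≠ j → ∀ w ∈ hardSphereDomain G n ε, ∀ t ∈ Icc 0 (τ / M),
      ‖G.sepVec ((freeFlight G (-t) w i).1) ((freeFlight G (-t) w j).1)‖ = ε →
        F (freeFlight G (-t) w) i j ≤ Ft M w i j) :
    ∫⁻ z, Φ.good.indicator (fun z =>
        ∑ᶠ s ∈ collisionTimes G ε (fun t => Φ.flow t z) ∩ Icc 0 τ,
          ∑ i, ∑ j, (if i ≠ j ∧ ‖G.sepVec (Φ.flow s z i).1 (Φ.flow s z j).1‖ = ε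
            then F (Φ.flow s z) i j else 0)) z ∂P ≤
      liminf (fun M : ℕ => (M : ℝ≥0∞) *
        ∫⁻ w, ∑ i, ∑ j, (if i ≠ j then (E M i j).indicator (fun w => Ft M w i j) w else 0) ∂P)
        atTop := by
  classical
  -- the one-window functional and the grid sums
  set W : ℕ → Config n d X → ℝ≥0∞ := fun M w => ∑ i, ∑ j,
    (if i ≠ j then (E M i j).indicator (fun w => Ft M w i j) w else 0) with hWdef
  have hWm : ∀ M, Measurable (W M) := by
    intro M
    refine Finset.measurable_sum _ fun i _ => Finset.measurable_sum _ fun j _ => ?_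
    by_cases hij : i ≠ j
    · simp only [if_pos hij]
      exact (hFtm M i j).indicator (hEm M i j)
    · simp only [if_neg hij]
      exact measurable_const
  set SM : ℕ → Config n d X → ℝ≥0∞ := fun M z =>
    ∑ k ∈ Finset.Icc 1 M, W M (Φ.flow ((k : ℝ) * (τ / M)) z) with hSMdef
  have hSMm : ∀ M, Measurable (SM M) := fun M =>
    Finset.measurable_sum _ fun k _ => (hWm M).comp (Φ.measurable_flow _)
  set Kstar : Config n d X → ℝ≥0∞ := fun z => liminf (fun M => SM M z) atTop with hKdef
  -- (i) the pathwise bound on the good set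
  have hpath : ∀ z ∈ Φ.good, (∑ᶠ s ∈ collisionTimes G ε (fun t => Φ.flow t z) ∩ Icc 0 τ,
      ∑ i, ∑ j, (if i ≠ j ∧ ‖G.sepVec (Φ.flow s z i).1 (Φ.flow s z j).1‖ = ε
        then F (Φ.flow s z) i j else 0)) ≤ Kstar z := by
    intro z hz
    have hγ := Φ.isTrajectory z hz
    have hfin := hγ.locFinite 0 τ
    rw [finsum_mem_eq_finite_toFinset_sum _ hfin]
    obtain ⟨g, hg, hgap⟩ := exists_gap_of_finite hfin
    show _ ≤ liminf (fun M => SM M z) atTop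
    refine le_liminf_of_le (h := ?_)
    filter_upwards [eventually_gt_atTop ⌈τ / g⌉₊] with M hM
    have hM0 : 0 < M := lt_of_le_of_lt (Nat.zero_le _) hM
    have hMg : τ / M < g := by
      have h1 : τ / g < M := (Nat.le_ceil _).trans_lt (by exact_mod_cast hM)
      rw [div_lt_iff₀ hg] at h1
      rw [div_lt_iff₀ (by exact_mod_cast hM0)]
      linarith
    have hgap' : ∀ s ∈ collisionTimes G ε (fun t => Φ.flow t z) ∩ Icc 0 τ,
        ∀ s' ∈ collisionTimes G ε (fun t => Φ.flow t z) ∩ Icc 0 τ, s < s' → τ / M < s' - s :=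
      fun s hs s' hs' hlt => hMg.trans_le (hgap s hs s' hs' hlt)
    exact sum_collision_le_sum_window hγ hτ hM0 hgap' (E M) (hE M) F (Ft M) (hFt M)
  -- (ii) the mean of each grid sum: stationarity
  have hmeanM : ∀ M, ∫⁻ z, SM M z ∂P = (M : ℝ≥0∞) * ∫⁻ w, W M w ∂P := by
    intro M
    calc ∫⁻ z, SM M z ∂P = ∑ k ∈ Finset.Icc 1 M, ∫⁻ z, W M (Φ.flow ((k : ℝ) * (τ / M)) z) ∂P :=
          lintegral_finsetSum _ fun k _ => (hWm M).comp (Φ.measurable_flow _)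
      _ = ∑ _k ∈ Finset.Icc 1 M, ∫⁻ z, W M z ∂P :=
          Finset.sum_congr rfl fun k _ => (hstat _).lintegral_comp (hWm M)
      _ = (M : ℝ≥0∞) * ∫⁻ w, W M w ∂P := by
          rw [Finset.sum_const, Nat.card_Icc, Nat.add_sub_cancel, nsmul_eq_mul]
  -- (iii) Fatou
  have hmean : ∫⁻ z, Kstar z ∂P ≤ liminf (fun M : ℕ => (M : ℝ≥0∞) * ∫⁻ w, W M w ∂P) atTop := by
    refine (lintegral_liminf_le hSMm).trans (le_of_eq ?_)
    exact congrArg (fun u : ℕ → ℝ≥0∞ => liminf u atTop) (funext hmeanM)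
  -- (iv) the indicator of the good set times the collision sum is below `Kstar` everywhere
  refine le_trans (lintegral_mono fun z => ?_) hmean
  by_cases hz : z ∈ Φ.good
  · rw [indicator_of_mem hz]
    exact hpath z hz
  · rw [indicator_of_notMem hz]
    exact zero_le

/-! ### Rung 0 on `𝕋³`: the mean collision sum of a velocity mark under the homogeneous Gibbs law -/

/-- **The collision-flux upper bound for the MEAN, rung 0.** For `σ ≤ 1/2`, constant profiles
`a, θ > 0`, `u`, a hard-sphere flow `Φ` of `N + 1` spheres of diameter `ε = hsDiameter σ N` on `𝕋³`
preserving the homogeneous Gibbs law `G_N` (`hstat`), a canonical pair law at most `4 ×` Haar measure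
(`hpair`, the Ruelle-type bound at small reduced density), swept-tube families of volume `≤ 4 ε² h ‖u‖`
(`htube`) and the Haar-versus-Lebesgue inequality for minimal-image lifts (`hlift`): for `τ > 0` and a
measurable mark `b(vᵢ, vⱼ) ∈ ℝ≥0∞` of the two (post-collisional) velocities,
`∫⁻ 𝟙_{good}(z) Σ_{collision times s ∈ [0,τ]} Σ_{ordered contact pairs (i,j)} b(vᵢ(s), vⱼ(s)) dG_N(z)
   ≤ 16 τ (N+1)² ε² · ∫ ‖p.2 − p.1‖ b(p) d(N(u,θ) ⊗ N(u,θ))(p)`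
(Cercignani–Illner–Pulvirenti 1994 App. 4.A: the Boltzmann–Enskog flux through the contact cylinders
bounds the mean collision sum; the mesh cancels exactly, `M · (τ/M) = τ`). [folklore] -/
theorem lintegral_indicator_collisionMarkSum_le {σ : ℝ} (hσ2 : σ ≤ 1 / 2) {a θ : ℝ} (ha : 0 < a)
    (hθ : 0 < θ) (u : V3) {N : ℕ}
    (Φ : HardSphereFlow (Torus.geometry (Fin 3)) (hsDiameter σ N) (N + 1))
    (hstat : ∀ t : ℝ, MeasurePreserving (Φ.flow t)
      (localGibbsLaw σ (fun _ => a) (fun _ => u) (fun _ => θ) N Φ)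
      (localGibbsLaw σ (fun _ => a) (fun _ => u) (fun _ => θ) N Φ))
    (hpair : ∀ i j : Fin (N + 1), i ≠ j → ∀ T : Set T3, MeasurableSet T →
      posGibbsMeasure (fun _ : T3 => (1 : ℝ)) (hsDiameter σ N) (N + 1) {x | x i - x j ∈ T} ≤
        4 * volume T)
    (htube : ∀ h : ℝ, 0 ≤ h → ∃ S : V3 → Set V3, MeasurableSet {q : V3 × V3 | q.1 ∈ S q.2} ∧
      (∀ u, volume (S u) ≤ ENNReal.ofReal (4 * hsDiameter σ N ^ 2 * h * ‖u‖)) ∧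
      ∀ (u r : V3) (s : ℝ), hsDiameter σ N ≤ ‖r‖ → s ∈ Icc 0 h → ‖r + s • u‖ = hsDiameter σ N →
        r ∈ S u)
    (hlift : ∀ B : Set V3, MeasurableSet B →
      volume {x : T3 | ∃ k : Fin 3 → ℤ, Torus.reprSym x + Torus.latticeVec k ∈ B} ≤ volume B)
    {τ : ℝ} (hτ : 0 < τ) {b : V3 × V3 → ℝ≥0∞} (hbm : Measurable b) :
    ∫⁻ z, Φ.good.indicator (fun z =>
        ∑ᶠ s ∈ collisionTimes (Torus.geometry (Fin 3)) (hsDiameter σ N) (fun t => Φ.flow t z) ∩ Icc 0 τ,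
          ∑ i : Fin (N + 1), ∑ j : Fin (N + 1),
            (if i ≠ j ∧ ‖(Torus.geometry (Fin 3)).sepVec (Φ.flow s z i).1 (Φ.flow s z j).1‖ =
                hsDiameter σ N then b ((Φ.flow s z i).2, (Φ.flow s z j).2) else 0)) z
        ∂(localGibbsLaw σ (fun _ => a) (fun _ => u) (fun _ => θ) N Φ) ≤
      ENNReal.ofReal (16 * τ * ((N + 1 : ℕ) : ℝ) ^ 2 * hsDiameter σ N ^ 2) *
        ∫⁻ p, ENNReal.ofReal ‖p.2 - p.1‖ * b p ∂((gaussMeasure u θ).prod (gaussMeasure u θ)) := by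
  classical
  set P := localGibbsLaw σ (fun _ => a) (fun _ => u) (fun _ => θ) N Φ with hPdef
  set I : ℝ≥0∞ := ∫⁻ p, ENNReal.ofReal ‖p.2 - p.1‖ * b p ∂((gaussMeasure u θ).prod (gaussMeasure u θ))
    with hIdef
  -- the mark: a function of the two (post-collisional) velocities, unchanged along free flight
  set F : Config (N + 1) (Fin 3) T3 → Fin (N + 1) → Fin (N + 1) → ℝ≥0∞ :=
    fun w i j => b ((w i).2, (w j).2) with hFdef
  have hFm : ∀ i j, Measurable fun w => F w i j :=
    fun i j => hbm.comp ((measurable_pi_apply i).snd.prodMk (measurable_pi_apply j).snd)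
  have hFfree : ∀ (t : ℝ) (w : Config (N + 1) (Fin 3) T3) (i j : Fin (N + 1)),
      F (freeFlight (Torus.geometry (Fin 3)) (-t) w) i j = F w i j := by
    intro t w i j
    simp only [hFdef, freeFlight_apply]
  -- the window events, for every mesh `τ / M` and every ordered pair
  have hev : ∀ (M : ℕ) (i j : Fin (N + 1)), ∃ E : Set (Config (N + 1) (Fin 3) T3), MeasurableSet E ∧
      (i ≠ j → ∀ w ∈ hardSphereDomain (Torus.geometry (Fin 3)) (N + 1) (hsDiameter σ N),
        ∀ t ∈ Icc 0 (τ / M),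
        ‖(Torus.geometry (Fin 3)).sepVec ((freeFlight (Torus.geometry (Fin 3)) (-t) w i).1)
          ((freeFlight (Torus.geometry (Fin 3)) (-t) w j).1)‖ = hsDiameter σ N → w ∈ E) ∧
      (i ≠ j → ∫⁻ w, E.indicator (fun w => F w i j) w ∂P ≤
        ENNReal.ofReal (16 * hsDiameter σ N ^ 2 * (τ / M)) * I) := by
    intro M i j
    by_cases hij : i ≠ j
    · have hh : 0 ≤ τ / M := div_nonneg hτ.le (Nat.cast_nonneg M)
      obtain ⟨S, hSm, hSvol, hS⟩ := htube (τ / M) hh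
      obtain ⟨E, hEm, hEc, hEb⟩ :=
        exists_windowEvent hσ2 ha hθ u hh hij (hpair i j hij) hSm hSvol hS hlift
      exact ⟨E, hEm, fun _ => hEc, fun _ => hEb Φ b hbm⟩
    · exact ⟨∅, MeasurableSet.empty, fun h => absurd h hij, fun h => absurd h hij⟩
  choose E hEm hEc hEb using hev
  -- the general window bound for the mean
  have hgen := lintegral_indicator_collisionSum_le_liminf Φ P hstat hτ F (fun M i j => E M i j) hEm
    (fun M i j hij => hEc M i j hij) (fun _ => F) (fun _ i j => hFm i j)
    (fun M i j _ w _ t _ _ => (hFfree t w i j).le)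
  -- the mean of one window: the static bound, `(N+1)²` ordered pairs, and `M · (τ/M) = τ`
  have hB : ∀ M : ℕ, (M : ℝ≥0∞) * ∫⁻ w, ∑ i, ∑ j,
      (if i ≠ j then (E M i j).indicator (fun w => F w i j) w else 0) ∂P ≤
        ENNReal.ofReal (16 * τ * ((N + 1 : ℕ) : ℝ) ^ 2 * hsDiameter σ N ^ 2) * I := by
    intro M
    rcases Nat.eq_zero_or_pos M with hM0 | hM0
    · subst hM0
      simp only [Nat.cast_zero, zero_mul, zero_le]
    have hterm : ∀ i j : Fin (N + 1), ∫⁻ w, (if i ≠ j then (E M i j).indicator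
        (fun w => F w i j) w else 0) ∂P ≤ ENNReal.ofReal (16 * hsDiameter σ N ^ 2 * (τ / M)) * I := by
      intro i j
      by_cases hij : i ≠ j
      · simp only [if_pos hij]; exact hEb M i j hij
      · simp only [if_neg hij, lintegral_zero, zero_le]
    have hmeas : ∀ i j : Fin (N + 1), Measurable fun w : Config (N + 1) (Fin 3) T3 =>
        (if i ≠ j then (E M i j).indicator (fun w => F w i j) w else 0) := by
      intro i j
      by_cases hij : i ≠ j
      · simp only [if_pos hij]; exact (hFm i j).indicator (hEm M i j)
      · simp only [if_neg hij]; exact measurable_const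
    calc (M : ℝ≥0∞) * ∫⁻ w, ∑ i, ∑ j, (if i ≠ j then (E M i j).indicator (fun w => F w i j) w else 0) ∂P
        = (M : ℝ≥0∞) * ∑ i, ∑ j,
            ∫⁻ w, (if i ≠ j then (E M i j).indicator (fun w => F w i j) w else 0) ∂P := by
          congr 1
          rw [lintegral_finsetSum _ fun i _ => Finset.measurable_sum _ fun j _ => hmeas i j]
          exact Finset.sum_congr rfl fun i _ => lintegral_finsetSum _ fun j _ => hmeas i j
      _ ≤ (M : ℝ≥0∞) * ∑ _i : Fin (N + 1), ∑ _j : Fin (N + 1),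
            ENNReal.ofReal (16 * hsDiameter σ N ^ 2 * (τ / M)) * I := by
          gcongr with i _ j _
          exact hterm i j
      _ = ENNReal.ofReal (16 * τ * ((N + 1 : ℕ) : ℝ) ^ 2 * hsDiameter σ N ^ 2) * I := by
          simp only [Finset.sum_const, Finset.card_univ, Fintype.card_fin, nsmul_eq_mul]
          have h1 : (M : ℝ≥0∞) = ENNReal.ofReal (M : ℝ) := (ENNReal.ofReal_natCast M).symm
          have h2 : ((N + 1 : ℕ) : ℝ≥0∞) = ENNReal.ofReal ((N + 1 : ℕ) : ℝ) :=
            (ENNReal.ofReal_natCast _).symm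
          rw [h1, h2, ← mul_assoc, ← mul_assoc, ← mul_assoc, ← ENNReal.ofReal_mul (Nat.cast_nonneg _),
            ← ENNReal.ofReal_mul (by positivity), ← ENNReal.ofReal_mul (by positivity)]
          congr 1
          congr 1
          field_simp
  exact hgen.trans (liminf_le_of_frequently_le' (Frequently.of_forall hB))

end Summit.AtomisticToContinuum.HydrodynamicLimit.Theorems.LambertianContactSwapCollisionMomentBound

end
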